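import Summits.BirchSwinnertonDyer.BirchSwinnertonDyer.Theorems.ResidualThetaTransportAtTwoResidualSignedLambdaLowerCMAtTwoLocalBlockCountFrobenius
import Literature.NumberTheory.EllipticCurves.SelmerCorankControlCoinvariantsProofs
import Literature.Algebra.Module.CharacterModuleCoNakayama
import Mathlib.LinearAlgebra.Dimension.Localization
import Mathlib.RingTheory.Localization.BaseChange
import HarnessLib

/-!
# The GOOD-PLACE LOCAL BLOCK of RSL_g's one-pair count on the AwayTwo frame's CARRIER OF RECORD
# `Dloc S κ ρ w = subgroupH1 (localSubgroup (ker κ) ℚ_w) (Cofree (ρ.toLocal w) F)` (rfl): FIN at every good place (any trace), `#Dloc[2^k] = #(𝒪/2^k)²`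
# (‖a‖ < 1), and — for ANY `ℤ₂`-module structure on `Dloc` — `CharacterModule Dloc` is finitely generated with `dim_{ℚ₂}(ℚ₂ ⊗ ·) = f·(if ‖a‖ < 1 then 2 else 0)`

Route `ResidualThetaTransportAtTwo` (RTT), crux RSL_g `ResidualSignedLambdaLowerCMAtTwo` (stmt-BirchSwinnertonDyer-22608); width seat
`prover-bsd-wall-tp2-p2x-w3` g16 (`--supports 22608 --as helper`, closes nothing). THEOREMS ONLY (no definition, no named fact, no instance, no notation,
no `sorry`). Fourth file of the local-block chain (p695381 abstract Greenberg–Vatsal corank form · p696637 cofree block, matrix currency · p696901 RSL_g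
currency + `zpCorank`). The LEAD's AwayTwo frame (`Cruxes/ResidualSignedLambdaLowerCMAtTwo/AWAYTWO-FRAME-g18.md`, bus 2026-08-29T04:56:41Z) fixes the
S₀-side carrier of line `onepair` as `Dloc S κ ρ w := continuousCohomology 1 (subgroupRep (localRepOf (cofreeGaloisModule S ρ) w) (kerGroup κ w))`, which is
BY `rfl` the type used throughout this chain, `subgroupH1 (localSubgroup κ.kerSubgroup (w.adicCompletion ℚ)) (Cofree (ρ.toLocal w) (padicCoeffField S))`
(LEAD's desk probe and this seat's probe, both rc 0); the S1⊕ text reads `Module.Finite` + `π.f * Σ_{good w} 2^{nfl w}·(if ‖ι a_ℓ‖ < 1 then 2 else 0) ≤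
lamTwo 2 (Π (w : good) (c : C w), CharacterModule (Dloc w))` with a binder instance `[∀ w, Module ℤ_[2] (Dloc w)]`. This file supplies, per good block
(`w ∤ 2` not split completely in `κ` — free for the cyclotomic `κ`, `exists_not_mem_localSubgroup_of_isCyclotomic` —, `ρ.IsUnramifiedAt w`,
`ρ.HasFrobCharpolyAt w P` with `P ↦ X² − C a X + C q`, `q` odd, `ϖ` irreducible, `B : ℤ₂^f ≃+ 𝒪` the pin `π.B`):

* §1 (abstract, any discrete `Γ_{K_v}`-module, ANY trace) `finite_torsionBy_subgroupH1_of_frob`: the layers `H¹(Hi, A)[p^k]` are finite (image of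
  `H¹(Hi, A[p^k])`, finite by the route UTD's count); hence **`finite_torsionBy_subgroupH1_cofree`: `Dloc[2^k]` finite for every `k`** (the FIN input);
* §2 **`natCard_torsionBy_subgroupH1_cofree_eq_pow_of_norm_lt_one`: `#Dloc[2^k] = #(𝒪/2^k 𝒪)²`** when `‖a‖ < 1` (RSL_g currency; the ODD case `Dloc = 0` and
  `zpCorank Dloc 2 = f·(if ‖a‖ < 1 then 2 else 0)` are p696901's `subgroupH1_cofree_eq_zero_of_not_norm_lt_one` / `zpCorank_subgroupH1_cofree_eq`);
* §3, for ANY `ℤ₂`-module structure on `Dloc` (the frame's binder instance, pinned or not): **`module_finite_characterModule_subgroupH1_cofree`**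
  (co-Nakayama over the `2`-adically complete `ℤ₂`, from `Dloc[2]` finite and `2`-power torsion; base change: `module_finite_baseChange_characterModule_subgroupH1_cofree`), **`finrank_characterModule_subgroupH1_cofree_eq`:
  `rank_{ℤ₂} CharacterModule Dloc = f·(if ‖a‖ < 1 then 2 else 0)`** (the tree's `finrank_eq_zpCorank_of_addEquiv_characterModule`) and
  **`finrank_baseChange_characterModule_subgroupH1_cofree_eq`: `dim_{ℚ₂} (ℚ₂ ⊗_{ℤ₂} CharacterModule Dloc) = f·(if ‖a‖ < 1 then 2 else 0)`** (= `OnePair.lamTwo 2 _`;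
  `IsLocalizedModule.finrank_eq` + `IsLocalization.rank_eq`) — the S1⊕ summand of one block; the `2^{nfl w}` copies are the `c : C w` factor and
  `lamTwo` of the product is the sum (`ImprimitiveDuality.finrank_baseChange_characterModule_pi`).

BSD is not proved by any of this; RSL_g (22608) is not proved here.
References: [GreenbergVatsal2000] §1 p. 7, §2 Prop. (2.4) and proof (arXiv p. 22); [GreenbergLNM1716] §1 (PDF p. 60), §3 Lemma 3.3; [Greenberg2006] §3 A
(proof of Prop. 3.2); [Greenberg1999] §1; [Kato2004Asterisque] §13.8 (p. 228).
-/

set_option autoImplicit false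
-- the Theorems namespace of this sub repeats the summit name by design (D-0017 nested layout)
set_option linter.dupNamespace false

noncomputable section

open scoped Classical TensorProduct

namespace Summit.BirchSwinnertonDyer.BirchSwinnertonDyer.Theorems.ThetaTransport.LocalBlockCount

open NumberField IsDedekindDomain Field
open Literature.NumberTheory.EllipticCurves Literature.NumberTheory.GaloisRepresentations
  Literature.NumberTheory.GaloisRepresentations.IsNonarchimedeanLocalField
  Literature.NumberTheory.EllipticCurves.GreenbergSelmer IsDedekindDomain.HeightOneSpectrum
  Summit.BirchSwinnertonDyer.BirchSwinnertonDyer.Theorems.UniversalToricDescentUnramifiedLocalCount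

/-! ## §1 Abstract: the layers `H¹(Hi, A)[p^k]` are FINITE at a finitely-decomposed `v ∤ p` (any trace) -/

section Abstract

variable {K : Type} [Field K] [NumberField K] {v : HeightOneSpectrum (𝓞 K)} {p : ℕ} [Fact p.Prime]
  (κ : ZpExtension K p)
  {A : Type} [AddCommGroup A] [DistribMulAction (absoluteGaloisGroup (v.adicCompletion K)) A]
  [TopologicalSpace A] [DiscreteTopology A]

/-- **`H¹(Hi, A)[p^k]` is finite** for a discrete `p`-divisible `Γ_{K_v}`-module `A` with finite layers, continuous orbit maps and trivial inertia action, at a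
place `v ∤ p` not split completely in `κ`: it is the image of `H¹(Hi, A[p^k])` (`range_pushTorsion_eq_torsionBy`), which UTD's count
`#H¹(Hi, B) = #{b ∈ B : φ^{p^R} b = q_v^{p^R} b}` (`B = A[p^k]` finite; the right side contains `0`) makes finite. No parity/trace hypothesis.
[cite: GreenbergVatsal2000, §2 Prop. (2.4) and proof (arXiv p. 22)] -/
theorem finite_torsionBy_subgroupH1_of_frob (hpv : (p : 𝓞 K) ∉ v.asIdeal)
    (hns : ∃ σ : absoluteGaloisGroup (v.adicCompletion K), σ ∉ localSubgroup κ.kerSubgroup (v.adicCompletion K))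
    {φ : absoluteGaloisGroup (v.adicCompletion K)} (hφ : IsFrobPow φ 1)
    (hdiv : ∀ a : A, ∃ b : A, p • b = a) (hfin : ∀ k : ℕ, Finite (AddSubgroup.torsionBy A ((p ^ k : ℕ) : ℤ)))
    (hcont : ∀ a : A, Continuous fun g : absoluteGaloisGroup (v.adicCompletion K) ↦ g • a)
    (hunr : ∀ σ ∈ absInertia (v.adicCompletion K), ∀ a : A, σ • a = a) (k : ℕ) :
    Finite (AddSubgroup.torsionBy (subgroupH1 (localSubgroup κ.kerSubgroup (v.adicCompletion K)) A) ((p ^ k : ℕ) : ℤ)) := by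
  haveI : Finite (AddSubgroup.torsionBy A ((p ^ k : ℕ) : ℤ)) := hfin k
  have hB : ∃ k' : ℕ, ∀ b : AddSubgroup.torsionBy A ((p ^ k : ℕ) : ℤ), p ^ k' • b = 0 :=
    ⟨k, fun b ↦ Subtype.ext (by rw [AddSubgroupClass.coe_nsmul, ZeroMemClass.coe_zero]; exact AddSubgroup.torsionBy.nsmul_iff.mp b.2)⟩
  have hcontB : ∀ b : AddSubgroup.torsionBy A ((p ^ k : ℕ) : ℤ),
      Continuous fun g : absoluteGaloisGroup (v.adicCompletion K) ↦ g • b := fun b ↦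
    continuous_induced_rng.mpr (by simpa only [Function.comp_def, AddSubgroup.torsionBy.coe_smul] using hcont (b : A))
  have hunrB : ∀ σ ∈ absInertia (v.adicCompletion K), ∀ b : AddSubgroup.torsionBy A ((p ^ k : ℕ) : ℤ), σ • b = b :=
    fun σ hσ b ↦ Subtype.ext (by rw [AddSubgroup.torsionBy.coe_smul]; exact hunr σ hσ _)
  obtain ⟨R₁, hR₁⟩ := exists_forall_natCard_subgroupH1_localSubgroup_eq κ hpv hns hB hcontB hunrB hφ
  have hne : Nat.card (subgroupH1 (localSubgroup κ.kerSubgroup (v.adicCompletion K)) (AddSubgroup.torsionBy A ((p ^ k : ℕ) : ℤ))) ≠ 0 := by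
    rw [hR₁ R₁ le_rfl]
    haveI : Nonempty {b : AddSubgroup.torsionBy A ((p ^ k : ℕ) : ℤ) // φ ^ p ^ R₁ • b = (residueFieldCard (v.adicCompletion K) ^ p ^ R₁) • b} :=
      ⟨⟨0, by rw [smul_zero, smul_zero]⟩⟩
    exact Nat.card_pos.ne'
  haveI := Nat.finite_of_card_ne_zero hne
  rw [← range_pushTorsion_eq_torsionBy κ (p ^ k) (exists_pow_nsmul_eq_of_forall_exists hdiv k) hcont]
  exact (Set.finite_range _).to_subtype

end Abstract

/-! ## §2 The carrier of record `Dloc = subgroupH1 (localSubgroup (ker κ) ℚ_w) (Cofree (ρ.toLocal w) F)`: FIN (any trace) and the even count `#(𝒪/2^k)²` -/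

section Carrier

variable (S : Set (PadicAlgCl 2)) [FiniteDimensional ℚ_[2] (padicCoeffField S)]
  (ρ : FramedGaloisRep ℚ (padicCoeffIntegers S) 2) (κ : ZpExtension ℚ 2) {w : HeightOneSpectrum (𝓞 ℚ)}

/-- **FIN on the carrier of record, ANY trace: `Dloc[2^k]` is finite** at a place `w ∤ 2` not split completely in `κ` where `ρ` is unramified
(§1 with the cofree hypotheses of p696637: `2`-divisible, finite layers, continuous orbit maps, inertia trivial through `ρ`). [cite: GreenbergVatsal2000, §2 Prop. (2.4)] -/
theorem finite_torsionBy_subgroupH1_cofree (h2w : ((2 : ℕ) : 𝓞 ℚ) ∉ w.asIdeal)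
    (hns : ∃ σ : absoluteGaloisGroup (w.adicCompletion ℚ), σ ∉ localSubgroup κ.kerSubgroup (w.adicCompletion ℚ))
    (hur : FramedGaloisRep.IsUnramifiedAt w ρ) (k : ℕ) :
    Finite (AddSubgroup.torsionBy (subgroupH1 (localSubgroup κ.kerSubgroup (w.adicCompletion ℚ)) (Cofree (ρ.toLocal w) (padicCoeffField S))) ((2 ^ k : ℕ) : ℤ)) := by
  obtain ⟨φ, hφ⟩ := exists_isFrobPow_holds (F := w.adicCompletion ℚ) 1
  exact finite_torsionBy_subgroupH1_of_frob κ h2w hns hφ (exists_two_nsmul_eq_cofree S ρ)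
    (fun k ↦ Summit.BirchSwinnertonDyer.BirchSwinnertonDyer.Theorems.LambdaLowerBoundO.finite_torsionBy_cofree_pow S ρ k) (continuous_smul_cofree S ρ)
    (fun σ hσ ↦ smul_cofree_eq_of_apply_eq_one S ρ (apply_absGaloisRestrict_eq_one_of_isUnramifiedAt S ρ hur hσ)) k

/-- **EVEN trace on the carrier of record, RSL_g currency: `#Dloc[2^k] = #(𝒪/2^k 𝒪)²`** (`‖a‖ < 1`; p696901's `…_eq_of_norm_lt_one` followed by
`natCard_torsionBy_cofree`). [cite: GreenbergVatsal2000, §2 Prop. (2.4)] [cite: Kato2004Asterisque, §13.8 (p. 228)] -/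
theorem natCard_torsionBy_subgroupH1_cofree_eq_pow_of_norm_lt_one (h2w : ((2 : ℕ) : 𝓞 ℚ) ∉ w.asIdeal)
    (hns : ∃ σ : absoluteGaloisGroup (w.adicCompletion ℚ), σ ∉ localSubgroup κ.kerSubgroup (w.adicCompletion ℚ))
    (hur : FramedGaloisRep.IsUnramifiedAt w ρ) {P : Polynomial (padicCoeffIntegers S)} (hP : FramedGaloisRep.HasFrobCharpolyAt w P ρ) {a : PadicAlgCl 2}
    {q : ℕ} (hq : Odd q) (hPmap : P.map (padicCoeffIntegers S).subtype = Polynomial.X ^ 2 - Polynomial.C a * Polynomial.X + Polynomial.C (q : PadicAlgCl 2))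
    {ϖ : padicCoeffIntegers S} (hϖ : Irreducible ϖ) (ha : ‖a‖ < 1) (k : ℕ) :
    Nat.card (AddSubgroup.torsionBy (subgroupH1 (localSubgroup κ.kerSubgroup (w.adicCompletion ℚ)) (Cofree (ρ.toLocal w) (padicCoeffField S))) ((2 ^ k : ℕ) : ℤ)) =
      Nat.card (padicCoeffIntegers S ⧸ Ideal.span {(2 : padicCoeffIntegers S) ^ k}) ^ 2 := by
  rw [natCard_torsionBy_subgroupH1_cofree_eq_of_norm_lt_one S ρ κ h2w hns hur hP hq hPmap hϖ ha k]
  exact Summit.BirchSwinnertonDyer.BirchSwinnertonDyer.Theorems.ThetaTransport.CofreeTorsionCount.natCard_torsionBy_cofree S ρ k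

end Carrier

/-! ## §3 S1⊕ packaging for ANY `ℤ₂`-module structure on `Dloc`: `CharacterModule Dloc` finitely generated, `dim_{ℚ₂}(ℚ₂ ⊗ ·) = f·(if ‖a‖ < 1 then 2 else 0)` -/

section Packaging

variable (S : Set (PadicAlgCl 2)) [FiniteDimensional ℚ_[2] (padicCoeffField S)]
  (ρ : FramedGaloisRep ℚ (padicCoeffIntegers S) 2) (κ : ZpExtension ℚ 2) {w : HeightOneSpectrum (𝓞 ℚ)}
  [Module ℤ_[2] (subgroupH1 (localSubgroup κ.kerSubgroup (w.adicCompletion ℚ)) (Cofree (ρ.toLocal w) (padicCoeffField S)))]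

/-- **FIN for S1⊕: `CharacterModule Dloc` is a finitely generated `ℤ₂`-module** for ANY `ℤ₂`-module structure on `Dloc` (e.g. the frame's binder instance),
at `w ∤ 2` not split completely in `κ` with `ρ` unramified: every class is `2`-power torsion (`exists_pow_nsmul_eq_zero`, and `(r : ℤ₂) ∈ (2)^k` acts through
`2^k •`), `Dloc[2]` is finite (`finite_torsionBy_subgroupH1_cofree`), `ℤ₂` is `(2)`-adically complete; co-Nakayama `CharacterModule.module_finite_of_finite_torsionBySet`.
[cite: Greenberg2006, §3 A (proof of Prop. 3.2)] [cite: GreenbergLNM1716, §1 (PDF p. 60)] -/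
theorem module_finite_characterModule_subgroupH1_cofree (h2w : ((2 : ℕ) : 𝓞 ℚ) ∉ w.asIdeal)
    (hns : ∃ σ : absoluteGaloisGroup (w.adicCompletion ℚ), σ ∉ localSubgroup κ.kerSubgroup (w.adicCompletion ℚ))
    (hur : FramedGaloisRep.IsUnramifiedAt w ρ) :
    Module.Finite ℤ_[2] (CharacterModule (subgroupH1 (localSubgroup κ.kerSubgroup (w.adicCompletion ℚ)) (Cofree (ρ.toLocal w) (padicCoeffField S)))) := by
  have hA : ∀ c : subgroupH1 (localSubgroup κ.kerSubgroup (w.adicCompletion ℚ)) (Cofree (ρ.toLocal w) (padicCoeffField S)), ∃ k : ℕ, 2 ^ k • c = 0 :=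
    exists_pow_nsmul_eq_zero κ (exists_pow_smul_cofree_eq_zero S (ρ.toLocal w))
  haveI : IsPrecomplete (Ideal.span {(2 : ℤ_[2])}) ℤ_[2] := by
    rw [show (2 : ℤ_[2]) = ((2 : ℕ) : ℤ_[2]) by norm_cast, ← PadicInt.maximalIdeal_eq_span_p]; infer_instance
  haveI := finite_torsionBy_subgroupH1_cofree S ρ κ h2w hns hur 1
  haveI : Finite (Submodule.torsionBySet ℤ_[2] (subgroupH1 (localSubgroup κ.kerSubgroup (w.adicCompletion ℚ)) (Cofree (ρ.toLocal w) (padicCoeffField S)))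
      ((Ideal.span {(2 : ℤ_[2])} : Ideal ℤ_[2]) : Set ℤ_[2])) := by
    refine Finite.of_injective (fun s ↦ (⟨s.1, AddSubgroup.torsionBy.nsmul_iff.mpr ?_⟩ :
      AddSubgroup.torsionBy (subgroupH1 (localSubgroup κ.kerSubgroup (w.adicCompletion ℚ)) (Cofree (ρ.toLocal w) (padicCoeffField S)))
        ((2 ^ 1 : ℕ) : ℤ))) (fun s t h ↦ Subtype.ext ?_)
    · have h := (Submodule.mem_torsionBySet_iff _ _).mp s.2 ⟨2, Ideal.subset_span rfl⟩
      rw [pow_one, ← Nat.cast_smul_eq_nsmul ℤ_[2], Nat.cast_ofNat]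
      exact h
    · exact congrArg (fun x : AddSubgroup.torsionBy (subgroupH1 (localSubgroup κ.kerSubgroup (w.adicCompletion ℚ))
        (Cofree (ρ.toLocal w) (padicCoeffField S))) ((2 ^ 1 : ℕ) : ℤ) ↦
          (x : subgroupH1 (localSubgroup κ.kerSubgroup (w.adicCompletion ℚ)) (Cofree (ρ.toLocal w) (padicCoeffField S)))) h
  refine Literature.Algebra.Module.CharacterModule.module_finite_of_finite_torsionBySet (Ideal.span {(2 : ℤ_[2])}) ⟨{2}, by simp⟩ fun s ↦ ?_
  obtain ⟨k, hk⟩ := hA s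
  refine ⟨k, fun r hr ↦ ?_⟩
  rw [Ideal.span_singleton_pow, Ideal.mem_span_singleton'] at hr
  obtain ⟨c, rfl⟩ := hr
  rw [mul_smul, show (2 : ℤ_[2]) ^ k = ((2 ^ k : ℕ) : ℤ_[2]) by norm_cast, Nat.cast_smul_eq_nsmul, hk, smul_zero]

/-- **FIN for S1⊕ in PUSH's binder form: `Module.Finite ℚ₂ (ℚ₂ ⊗_{ℤ₂} CharacterModule Dloc)`** (base change of the previous theorem; the S1⊕ text's
`Module.Finite ℚ_[2] (ℚ_[2] ⊗[ℤ_[2]] P_S)` is the finite product of these over `(w, c)`). [cite: Greenberg2006, §3 A (proof of Prop. 3.2)] -/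
theorem module_finite_baseChange_characterModule_subgroupH1_cofree (h2w : ((2 : ℕ) : 𝓞 ℚ) ∉ w.asIdeal)
    (hns : ∃ σ : absoluteGaloisGroup (w.adicCompletion ℚ), σ ∉ localSubgroup κ.kerSubgroup (w.adicCompletion ℚ))
    (hur : FramedGaloisRep.IsUnramifiedAt w ρ) :
    Module.Finite ℚ_[2] (ℚ_[2] ⊗[ℤ_[2]] CharacterModule (subgroupH1 (localSubgroup κ.kerSubgroup (w.adicCompletion ℚ)) (Cofree (ρ.toLocal w) (padicCoeffField S)))) := by
  haveI := module_finite_characterModule_subgroupH1_cofree S ρ κ h2w hns hur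
  infer_instance

/-- **COUNT for S1⊕, `ℤ₂`-rank form: `rank_{ℤ₂} CharacterModule Dloc = f · (if ‖a‖ < 1 then 2 else 0)`** for ANY `ℤ₂`-module structure on `Dloc`
(the tree's `finrank_eq_zpCorank_of_addEquiv_characterModule` on p696901's `zpCorank_subgroupH1_cofree_eq`). [cite: GreenbergVatsal2000, §2 Prop. (2.4)]
[cite: Greenberg1999, §1] -/
theorem finrank_characterModule_subgroupH1_cofree_eq (h2w : ((2 : ℕ) : 𝓞 ℚ) ∉ w.asIdeal)
    (hns : ∃ σ : absoluteGaloisGroup (w.adicCompletion ℚ), σ ∉ localSubgroup κ.kerSubgroup (w.adicCompletion ℚ))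
    (hur : FramedGaloisRep.IsUnramifiedAt w ρ) {P : Polynomial (padicCoeffIntegers S)} (hP : FramedGaloisRep.HasFrobCharpolyAt w P ρ) {a : PadicAlgCl 2}
    {q : ℕ} (hq : Odd q) (hPmap : P.map (padicCoeffIntegers S).subtype = Polynomial.X ^ 2 - Polynomial.C a * Polynomial.X + Polynomial.C (q : PadicAlgCl 2))
    {ϖ : padicCoeffIntegers S} (hϖ : Irreducible ϖ) {f : ℕ} (B : (Fin f → ℤ_[2]) ≃+ padicCoeffIntegers S) :
    Module.finrank ℤ_[2] (CharacterModule (subgroupH1 (localSubgroup κ.kerSubgroup (w.adicCompletion ℚ)) (Cofree (ρ.toLocal w) (padicCoeffField S)))) =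
      f * (if ‖a‖ < 1 then 2 else 0) := by
  have hA : ∀ c : subgroupH1 (localSubgroup κ.kerSubgroup (w.adicCompletion ℚ)) (Cofree (ρ.toLocal w) (padicCoeffField S)), ∃ k : ℕ, 2 ^ k • c = 0 :=
    exists_pow_nsmul_eq_zero κ (exists_pow_smul_cofree_eq_zero S (ρ.toLocal w))
  haveI := module_finite_characterModule_subgroupH1_cofree S ρ κ h2w hns hur
  haveI : Finite (AddSubgroup.torsionBy (subgroupH1 (localSubgroup κ.kerSubgroup (w.adicCompletion ℚ)) (Cofree (ρ.toLocal w) (padicCoeffField S))) ((2 : ℕ) : ℤ)) := by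
    simpa only [pow_one] using finite_torsionBy_subgroupH1_cofree S ρ κ h2w hns hur 1
  rw [Literature.NumberTheory.EllipticCurves.ZpCorank.finrank_eq_zpCorank_of_addEquiv_characterModule 2 hA (AddEquiv.refl _)]
  exact zpCorank_subgroupH1_cofree_eq S ρ κ h2w hns hur hP hq hPmap hϖ B

/-- **COUNT for S1⊕ in the `lamTwo` currency: `dim_{ℚ₂} (ℚ₂ ⊗_{ℤ₂} CharacterModule Dloc) = f · (if ‖a‖ < 1 then 2 else 0)`** (= `OnePair.lamTwo 2 (CharacterModule Dloc)`)
for ANY `ℤ₂`-module structure on `Dloc`: the `ℤ₂`-rank is invariant under localisation at `ℤ₂ ∖ 0` (`IsLocalizedModule.finrank_eq`, `IsLocalization.rank_eq`).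
Summing over the `2^{nfl w}` copies `c : C w` and the good `w ∈ S₀` gives S1⊕'s count with equality. [cite: GreenbergVatsal2000, §1 p. 7, §2 Prop. (2.4)]
[cite: Kato2004Asterisque, §13.8 (p. 228)] -/
theorem finrank_baseChange_characterModule_subgroupH1_cofree_eq (h2w : ((2 : ℕ) : 𝓞 ℚ) ∉ w.asIdeal)
    (hns : ∃ σ : absoluteGaloisGroup (w.adicCompletion ℚ), σ ∉ localSubgroup κ.kerSubgroup (w.adicCompletion ℚ))
    (hur : FramedGaloisRep.IsUnramifiedAt w ρ) {P : Polynomial (padicCoeffIntegers S)} (hP : FramedGaloisRep.HasFrobCharpolyAt w P ρ) {a : PadicAlgCl 2}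
    {q : ℕ} (hq : Odd q) (hPmap : P.map (padicCoeffIntegers S).subtype = Polynomial.X ^ 2 - Polynomial.C a * Polynomial.X + Polynomial.C (q : PadicAlgCl 2))
    {ϖ : padicCoeffIntegers S} (hϖ : Irreducible ϖ) {f : ℕ} (B : (Fin f → ℤ_[2]) ≃+ padicCoeffIntegers S) :
    Module.finrank ℚ_[2] (ℚ_[2] ⊗[ℤ_[2]] CharacterModule (subgroupH1 (localSubgroup κ.kerSubgroup (w.adicCompletion ℚ)) (Cofree (ρ.toLocal w) (padicCoeffField S)))) =
      f * (if ‖a‖ < 1 then 2 else 0) := by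
  rw [← finrank_characterModule_subgroupH1_cofree_eq S ρ κ h2w hns hur hP hq hPmap hϖ B,
    ← IsLocalizedModule.finrank_eq (nonZeroDivisors ℤ_[2])
      (TensorProduct.mk ℤ_[2] ℚ_[2] (CharacterModule (subgroupH1 (localSubgroup κ.kerSubgroup (w.adicCompletion ℚ)) (Cofree (ρ.toLocal w) (padicCoeffField S)))) 1)
      le_rfl]
  unfold Module.finrank
  rw [IsLocalization.rank_eq ℚ_[2] (nonZeroDivisors ℤ_[2]) le_rfl]

end Packaging

end Summit.BirchSwinnertonDyer.BirchSwinnertonDyer.Theorems.ThetaTransport.LocalBlockCount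

end
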